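import Summits.HodgeConjecture.HodgeConjecture.Theorems.Ring2AbelianAllAndreInvariantHomNumAtoms
import Summits.HodgeConjecture.HodgeConjecture.Theorems.Ring2AbelianAllAndreHodgeInvariantLattice
import HarnessLib

/-!
# Ring 2 · sub-cell AbelianAll (ALL ABELIAN VARIETIES), André axis, part XXX-d — `Div[t,q] ⟺ (L)_t(q) ∧ (FibAlg)_t(q)`; THE LIFT AS A
# NUMBER: `(L)_t(p)` iff the total space carries at least `dim (N^{d-p}(X_t) ∩ Im j_t^*)` independent algebraic classes of codimension
# `p` modulo `ker j_t^*`; at a CM fibre under `HC_CM` the target number is `dim (Hdg^p(X_t) ⊗ ℂ ∩ Im j_t^*)`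

HONEST FRAMING (page 1, verbatim): **research route, not a corollary; conditional on HC_CM plus one named
minimal statement.** Cell line: research route conditional on HC_CM; not a corollary; Q11.4-sentence-2
already refuted in dim ≥ 3. Nothing in this file proves a case of the Hodge conjecture for an abelian variety.
`HC_CM` = `Theses.RankFourFaces.CMAbelianHodge` is a BINDER in the two rows where it occurs (§3); `HC_AV` =
`Theses.PadicSemiregularLift.HodgeAbelianVarieties`; item `Theses.RankFourFaces.CMToAbelian` (stmt-HodgeConjecture-16267) OPEN and
not closed here. Seat `pub-hodge-ring2-ab-andre-2`, gen 22; brief (ii)/(iii) ("smallest open instance stated as a find-the-cycle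
problem … numbers, not adjectives"). Sequel of parts XXX-a/b/c (`Ring2AbelianAllAndreInvariantHomNum[Division|Atoms]`).

## What is proved (theorems only; no definition, no named fact, no sorry; brackets are `local notation3`)

§1 (the last atom identity, elementary): `fibAlg_of_fibreClassDivisionAt`, **`fibreClassDivisionAt_iff_comap_le_sup_and_fibAlg`**
(`Div[t,q] ⟺ (L)_t(q) ∧ (FibAlg)_t(q)`), `fibreClassDivisionAt_and_comap_le_sup_iff` (`Div[t,q] ∧ (L)_t(p) ⟺ (Num₂)(t,q) ∧ (L)_t(q)`).
§2 THE RANK FORM: **`comap_le_sup_iff_finrank_le`** — (L)_t(p) iff `dim (N^p(X_t) ∩ Im j_t^*) ≤ dim j_t^* N^p(𝒳)` (the reverse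
inequality always holds); **`comap_le_sup_iff_finrank_compl_le`** — iff `dim (N^q(X_t) ∩ Im j_t^*) ≤ dim j_t^* N^p(𝒳)`, `p + q = d`
(part XXX-c's `dim N^p_inv = dim N^q_inv`): FIND `dim N^q_inv` INDEPENDENT CODIMENSION-`p` CYCLES ON `𝒳` MODULO `ker j_t^*`.
§3 at a CM point under `HC_CM` (binder): **`comap_le_sup_iff_finrank_hodge_le_of_HC_CM`** — (L)_t(p) iff
`dim (Hdg^p(X_t) ⊗ ℂ ∩ Im j_t^*) ≤ dim j_t^* N^p(𝒳)`; and the cell row in rank form **`HC_AV_of_HC_CM_of_finrank`**: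
`h₂₁ → HC_CM → [at every CM point of every compact abelian pencil and every p, dim (Hdg^p(X_t) ⊗ ℂ ∩ Im j_t^*) ≤ dim j_t^* N^p(𝒳)] → HC_AV`
— ONE INEQUALITY OF RANKS per (pencil, CM point, degree). (Rev. 2, REFEREE-AB F-ab-122 / ab-spread-1 part XXXI
`HC_CM_of_finrank_hodge_le`: this HODGE rank form implies `HC_CM` by itself on constant pencils, so it is a PIVOT equivalent to `HC_AV`
modulo [Lemme 6.3.1, Verdier], NOT an `HC_CM`-idle complement; the `HC_CM`-idle forms of the André axis are the ALGEBRAIC-input ones —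
(L), Num^{CM,inv}, Det^CM and the algebraic rank form `comap_le_sup_iff_finrank_le` of §2.) §4 **`forall_comap_le_sup_iff_le_half`**,
**`cmFibreAlgebraicLift_iff_le_half`** — only the degrees `2p ≤ d` matter (part XXX-b: hard Lefschetz moves the lift up). Not claimed
minimal; no node born.

References: Kleiman1968AlgebraicCycles (§3 (D(X))); Lieberman1968 (main theorem); Milne2020HodgeClassesAV (Prop. 1 p. 7);
Andre1996Motifs (§5.1, Lemme 6.3.1 p. 31, §6.3 a) and Remarque 2 p. 33); DeligneHodgeII1971 (Thm. 4.1.1, Cor. 4.1.2);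
Deligne2000 (§1); Grothendieck1968 (§3 p. 196); Abdulali1994FamiliesAV (Conj. 5.3 p. 1130).
-/

noncomputable section

set_option linter.dupNamespace false

namespace Summit.HodgeConjecture.HodgeConjecture.Ring2.AbelianAll

open CategoryTheory AlgebraicGeometry
open Literature.AlgebraicGeometry Literature.AlgebraicGeometry.Motives
open Literature.AlgebraicGeometry.HodgeTheory
open Literature.AlgebraicTopology.SingularHomology (singularCohomology cupProduct cupProduct_gradedComm_holds)
open Literature.AlgebraicGeometry.Deligne1982 (cmLocus)
open Literature.AlgebraicGeometry.Andre1996 (andre1996_cmAnchoredPencil)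
open Summit.HodgeConjecture.HodgeConjecture.Theses

variable {𝒳 S : SchemeOver ℂ} {d : ℕ} {f : 𝒳 ⟶ S}

/-- (Div) `Div[hf, t, p]` — division by the fibre class at `t` in degree `2p` (part XXIX-c's display-only bracket, restated verbatim):
`L_t⁻¹ N^{p+1}(𝒳) ≤ N^p(𝒳) + ker j_t^*`, `L_t = j_{t*} j_t^*`. [cite: Grothendieck1968, §3 p. 196 (A(X, L))]
[cite: Abdulali1994FamiliesAV, Conjecture 5.3 (p. 1130)] -/
local notation3 "Div[" hf ", " t ", " p "]" =>
  Submodule.comap ((fiberGysin hf t p) ∘ₗ (complexBetti.map (fiberι f t) (2 * p)).hom) (algebraicClasses 𝒳 (p + 1)) ≤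
    algebraicClasses 𝒳 p ⊔ LinearMap.ker (complexBetti.map (fiberι f t) (2 * p)).hom

/-- (FibAlg) `FibAlg[hf, t, q]` — "an invariant class whose fibre-class multiple is algebraic on `𝒳` is algebraic on the fibre"
(part XXX-c's display-only bracket, restated verbatim): `L_t⁻¹ N^{q+1}(𝒳) ≤ (j_t^*)⁻¹ N^q(X_t)`. [cite: Kleiman1968AlgebraicCycles, §3 (D(X))] -/
local notation3 "FibAlg[" hf ", " t ", " q "]" =>
  Submodule.comap ((fiberGysin hf t q) ∘ₗ (complexBetti.map (fiberι f t) (2 * q)).hom) (algebraicClasses 𝒳 (q + 1)) ≤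
    (algebraicClasses (fiberOver f t) q).comap (complexBetti.map (fiberι f t) (2 * q)).hom

/-! ## §1 `Div[t, q] ⟺ (L)_t(q) ∧ (FibAlg)_t(q)` -/

/-- **`Div[t,q] ⟹ (FibAlg)_t(q)`**: `x = x' + k` with `x'` algebraic and `j_t^* k = 0`, so `j_t^* x = j_t^* x'` is algebraic on the fibre.
[cite: Fulton1998, §19.1 and Prop. 19.1.2] -/
theorem fibAlg_of_fibreClassDivisionAt (hf : IsCompactAbelianPencil f d) (t : ComplexPoints S) (q : ℕ) (hDiv : Div[hf, t, q]) :
    FibAlg[hf, t, q] := by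
  intro x hx
  obtain ⟨x', hx', k, hk, hxk⟩ := Submodule.mem_sup.1 (hDiv hx)
  rw [LinearMap.mem_ker] at hk
  rw [Submodule.mem_comap, ← hxk, map_add, hk, add_zero]
  exact algebraicClasses_sup_ker_le_comap hf q t (Submodule.mem_sup_left hx')

/-- **`Div[t,q] ⟺ (L)_t(q) ∧ (FibAlg)_t(q)`** — division by the fibre class is EXACTLY the lift in the same degree plus "invariant classes
with algebraic fibre-class multiple are algebraic on the fibre" (elementary; no parity condition, no Hodge hypothesis).
[cite: Grothendieck1968, §3 p. 196] [cite: Milne2020HodgeClassesAV, Prop. 1 (p. 7)] -/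
theorem fibreClassDivisionAt_iff_comap_le_sup_and_fibAlg (hf : IsCompactAbelianPencil f d) (t : ComplexPoints S) (q : ℕ) :
    Div[hf, t, q] ↔
      ((algebraicClasses (fiberOver f t) q).comap (complexBetti.map (fiberι f t) (2 * q)).hom ≤
          algebraicClasses 𝒳 q ⊔ LinearMap.ker (complexBetti.map (fiberι f t) (2 * q)).hom) ∧ FibAlg[hf, t, q] :=
  ⟨fun h ↦ ⟨comap_le_sup_of_fibreClassDivisionAt hf h, fibAlg_of_fibreClassDivisionAt hf t q h⟩,
    fun ⟨hL, hFib⟩ _ hx ↦ hL (hFib hx)⟩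

/-- **`Div[t,q] ∧ (L)_t(p) ⟺ (Num₂)(t,q) ∧ (L)_t(q)`** (`p + q = d`): both sides are `(L)_t(p) ∧ (L)_t(q) ∧ (FibAlg)_t(q)` (part XXX-c §4 and §1).
[cite: Kleiman1968AlgebraicCycles, §3 (D(X))] -/
theorem fibreClassDivisionAt_and_comap_le_sup_iff (hf : IsCompactAbelianPencil f d) (t : ComplexPoints S) {p q : ℕ}
    (hpq : p + q = d) :
    (Div[hf, t, q] ∧
        (algebraicClasses (fiberOver f t) p).comap (complexBetti.map (fiberι f t) (2 * p)).hom ≤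
          algebraicClasses 𝒳 p ⊔ LinearMap.ker (complexBetti.map (fiberι f t) (2 * p)).hom) ↔
      ((∀ x : complexBetti 𝒳 (2 * q),
          fiberGysin hf t q (complexBetti.map (fiberι f t) (2 * q) x) ∈ algebraicClasses 𝒳 (q + 1) →
          (∀ w ∈ algebraicClasses 𝒳 p, cupProduct (show 2 * (q + 1) + 2 * p = 2 * (d + 1) by omega)
              (fiberGysin hf t q (complexBetti.map (fiberι f t) (2 * q) x)) w = 0) →
            fiberGysin hf t q (complexBetti.map (fiberι f t) (2 * q) x) = 0) ∧
        (algebraicClasses (fiberOver f t) q).comap (complexBetti.map (fiberι f t) (2 * q)).hom ≤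
          algebraicClasses 𝒳 q ⊔ LinearMap.ker (complexBetti.map (fiberι f t) (2 * q)).hom) := by
  rw [fibreClassDivisionAt_iff_comap_le_sup_and_fibAlg hf t q, numerical₂_iff_comap_le_sup_and_fibAlg hf t hpq]
  tauto


/-! ## §2 The lift as a number -/

/-- **THE RANK FORM OF THE LIFT: (L)_t(p) iff `dim (N^p(X_t) ∩ Im j_t^*) ≤ dim j_t^* N^p(𝒳)`** — the restricted global algebraic
classes always lie inside the invariant algebraic classes (`map_algebraicClasses_le_inf_range`), and (L)_t(p) is the equality
(parts XXX-a/c `inf_range_eq_map_of_comap_le_sup`, `comap_le_sup_of_map_eq_inf_range`); between nested finite-dimensional subspaces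
equality is the inequality of dimensions. [cite: Milne2020HodgeClassesAV, Prop. 1 (p. 7)] [cite: Andre1996Motifs, §5.1 (p. 25)] -/
theorem comap_le_sup_iff_finrank_le (hf : IsCompactAbelianPencil f d) (t : ComplexPoints S) (p : ℕ) :
    (algebraicClasses (fiberOver f t) p).comap (complexBetti.map (fiberι f t) (2 * p)).hom ≤
        algebraicClasses 𝒳 p ⊔ LinearMap.ker (complexBetti.map (fiberι f t) (2 * p)).hom ↔
      Module.finrank ℂ ↥(algebraicClasses (fiberOver f t) p ⊓ LinearMap.range (complexBetti.map (fiberι f t) (2 * p)).hom) ≤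
        Module.finrank ℂ ↥((algebraicClasses 𝒳 p).map (complexBetti.map (fiberι f t) (2 * p)).hom) := by
  haveI := finite_complexBetti (hf.isSmoothProjective_fiberOver t) (2 * p)
  refine ⟨fun hL ↦ ?_, fun h ↦ comap_le_sup_of_map_eq_inf_range t p ?_⟩
  · rw [inf_range_eq_map_of_comap_le_sup hf t p hL]
  · exact Submodule.eq_of_le_of_finrank_eq (map_algebraicClasses_le_inf_range hf t p)
      (le_antisymm (Submodule.finrank_mono (map_algebraicClasses_le_inf_range hf t p)) h)

/-- **(L)_t(p) iff `dim (N^q(X_t) ∩ Im j_t^*) ≤ dim j_t^* N^p(𝒳)`, `p + q = d`** (part XXX-c: `dim N^p_inv = dim N^q_inv`, from the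
unconditional hom ≡ num on invariant algebraic classes): the lift in degree `2p` holds iff the total space carries at least as many
independent algebraic classes of codimension `p` modulo `ker j_t^*` as the fibre has independent invariant algebraic classes of the
COMPLEMENTARY degree `2q` — FIND THAT MANY CYCLES. [cite: Kleiman1968AlgebraicCycles, §3 (D(X))] [cite: Lieberman1968, main theorem]
[cite: Milne2020HodgeClassesAV, Prop. 1 (p. 7)] -/
theorem comap_le_sup_iff_finrank_compl_le (hf : IsCompactAbelianPencil f d) (t : ComplexPoints S) {p q : ℕ} (hpq : p + q = d) :
    (algebraicClasses (fiberOver f t) p).comap (complexBetti.map (fiberι f t) (2 * p)).hom ≤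
        algebraicClasses 𝒳 p ⊔ LinearMap.ker (complexBetti.map (fiberι f t) (2 * p)).hom ↔
      Module.finrank ℂ ↥(algebraicClasses (fiberOver f t) q ⊓ LinearMap.range (complexBetti.map (fiberι f t) (2 * q)).hom) ≤
        Module.finrank ℂ ↥((algebraicClasses 𝒳 p).map (complexBetti.map (fiberι f t) (2 * p)).hom) := by
  rw [comap_le_sup_iff_finrank_le hf t p, finrank_inf_range_eq hf t hpq]

/-! ## §3 At a CM fibre under `HC_CM`: the target number is the rank of the invariant Hodge classes -/

/-- **Under `HC_CM`, at a CM point the invariant algebraic classes are the invariant Hodge span**: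
`N^p(X_t) ∩ Im j_t^* = (Hdg^p(X_t) ⊗ ℂ) ∩ Im j_t^*` (part XVII-c's `C_t = D_t` pushed forward along `j_t^*`). `HC_CM` is a BINDER.
[cite: Andre1996Motifs, §6.3 a) (p. 33)] [cite: Deligne2000, §1] -/
theorem inf_range_eq_hodgeSpan_inf_range_of_HC_CM (hCM : RankFourFaces.CMAbelianHodge) (hf : IsCompactAbelianPencil f d)
    (p : ℕ) {t : ComplexPoints S} (ht : t ∈ cmLocus f d) :
    algebraicClasses (fiberOver f t) p ⊓ LinearMap.range (complexBetti.map (fiberι f t) (2 * p)).hom =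
      Submodule.span ℂ {c : complexBetti (fiberOver f t) (2 * p) |
          IsRationalClass c ∧ IsOfHodgeType d (fiberOver f t) (2 * p) p p c} ⊓
        LinearMap.range (complexBetti.map (fiberι f t) (2 * p)).hom := by
  have h := congrArg (Submodule.map (complexBetti.map (fiberι f t) (2 * p)).hom)
    (comap_algebraicClasses_eq_comap_hodgeSpan_of_HC_CM hCM hf p ht)
  simp only [Submodule.map_comap_eq] at h
  rw [inf_comm, h, inf_comm]

/-- **`HC_CM ⊢` at a CM point `t`: (L)_t(p) iff `dim ((Hdg^p(X_t) ⊗ ℂ) ∩ Im j_t^*) ≤ dim j_t^* N^p(𝒳)`** — the André-axis input at a CM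
fibre as ONE INEQUALITY OF RANKS: the total space must carry at least as many independent codimension-`p` algebraic classes modulo
`ker j_t^*` as the CM fibre has independent INVARIANT HODGE classes of degree `2p`. `HC_CM` is a BINDER.
[cite: Andre1996Motifs, §6.3 a) and Remarque 2 (p. 33)] [cite: Milne2020HodgeClassesAV, Prop. 1 (p. 7)] -/
theorem comap_le_sup_iff_finrank_hodge_le_of_HC_CM (hCM : RankFourFaces.CMAbelianHodge) (hf : IsCompactAbelianPencil f d)
    (p : ℕ) {t : ComplexPoints S} (ht : t ∈ cmLocus f d) :
    (algebraicClasses (fiberOver f t) p).comap (complexBetti.map (fiberι f t) (2 * p)).hom ≤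
        algebraicClasses 𝒳 p ⊔ LinearMap.ker (complexBetti.map (fiberι f t) (2 * p)).hom ↔
      Module.finrank ℂ ↥(Submodule.span ℂ {c : complexBetti (fiberOver f t) (2 * p) |
            IsRationalClass c ∧ IsOfHodgeType d (fiberOver f t) (2 * p) p p c} ⊓
          LinearMap.range (complexBetti.map (fiberι f t) (2 * p)).hom) ≤
        Module.finrank ℂ ↥((algebraicClasses 𝒳 p).map (complexBetti.map (fiberι f t) (2 * p)).hom) := by
  rw [comap_le_sup_iff_finrank_le hf t p, inf_range_eq_hodgeSpan_inf_range_of_HC_CM hCM hf p ht]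

/-- **THE CELL ROW IN RANK FORM: `h₂₁ → HC_CM → [at every CM point of every compact abelian pencil, in every degree `2p`,
`dim ((Hdg^p(X_t) ⊗ ℂ) ∩ Im j_t^*) ≤ dim j_t^* N^p(𝒳)`] → HC_AV`** (part IV's `HC_AV_of_HC_CM_and_cmFibreAlgebraicLift`, with the
lift node in its lattice form, part XVII-b, and §3). `h₂₁` (André's Lemme 6.3.1) and `HC_CM` are BINDERS; the rank hypothesis is a
HODGE-input form which already implies `HC_CM` on constant pencils (ab-spread-1 part XXXI `HC_CM_of_finrank_hodge_le`; REFEREE-AB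
F-ab-122): a PIVOT equivalent to `HC_AV`, not an `HC_CM`-idle complement, and not claimed minimal. research route, not a corollary; conditional on HC_CM plus one named
minimal statement. [cite: Andre1996Motifs, Lemme 6.3.1 (p. 31) and Remarque 2 (p. 33)] [cite: Milne2020HodgeClassesAV, Prop. 1 (p. 7)] -/
theorem HC_AV_of_HC_CM_of_finrank (h₂₁ : andre1996_cmAnchoredPencil) (hCM : RankFourFaces.CMAbelianHodge)
    (h : ∀ ⦃d : ℕ⦄ ⦃𝒳 S : SchemeOver ℂ⦄ (f : 𝒳 ⟶ S), IsCompactAbelianPencil f d → ∀ (p : ℕ), ∀ t ∈ cmLocus f d,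
      Module.finrank ℂ ↥(Submodule.span ℂ {c : complexBetti (fiberOver f t) (2 * p) |
            IsRationalClass c ∧ IsOfHodgeType d (fiberOver f t) (2 * p) p p c} ⊓
          LinearMap.range (complexBetti.map (fiberι f t) (2 * p)).hom) ≤
        Module.finrank ℂ ↥((algebraicClasses 𝒳 p).map (complexBetti.map (fiberι f t) (2 * p)).hom)) :
    PadicSemiregularLift.HodgeAbelianVarieties :=
  HC_AV_of_HC_CM_and_cmFibreAlgebraicLift h₂₁ hCM
    (cmFibreAlgebraicLift_iff_comap_le_sup.2 fun _ _ _ f hf p t ht ↦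
      (comap_le_sup_iff_finrank_hodge_le_of_HC_CM hCM hf p ht).2 (h f hf p t ht))

/-! ## §4 Only the degrees `2p ≤ d` matter -/

/-- **The lift in ALL degrees ⟺ the lift in the degrees `2p ≤ d`** (part XXX-b `comap_le_sup_compl_of_le'`: hard Lefschetz on the abelian
fibre moves the lift up; degrees `2p > 2d` are vacuous). So on a compact pencil of abelian `d`-folds the André-axis input lives in the
lower half of the degrees only: `d = 4`: `p = 2`; `d = 5`: `p = 2`; `d = 6`: `p ∈ {2, 3}` (degrees `p ≤ 1` being unconditional, part XVIII-i).
[cite: VoisinHodgeI2002, §6.2.3 Thm. 6.25] [cite: Lieberman1968, main theorem] [cite: Milne2020HodgeClassesAV, Prop. 1 (p. 7)] -/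
theorem forall_comap_le_sup_iff_le_half (hf : IsCompactAbelianPencil f d) (t : ComplexPoints S) :
    (∀ p : ℕ, (algebraicClasses (fiberOver f t) p).comap (complexBetti.map (fiberι f t) (2 * p)).hom ≤
        algebraicClasses 𝒳 p ⊔ LinearMap.ker (complexBetti.map (fiberι f t) (2 * p)).hom) ↔
      ∀ p : ℕ, 2 * p ≤ d → (algebraicClasses (fiberOver f t) p).comap (complexBetti.map (fiberι f t) (2 * p)).hom ≤
        algebraicClasses 𝒳 p ⊔ LinearMap.ker (complexBetti.map (fiberι f t) (2 * p)).hom := by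
  refine ⟨fun h p _ ↦ h p, fun h p ↦ ?_⟩
  by_cases hp : 2 * p ≤ d
  · exact h p hp
  rcases le_or_gt p d with hpd | hpd
  · exact comap_le_sup_compl_of_le' hf t (show (d - p) + p = d by omega) (by omega) (h (d - p) (by omega))
  · haveI := subsingleton_complexBetti (hf.isSmoothProjective_fiberOver t) (show 2 * d < 2 * p by omega)
    intro W _
    refine Submodule.mem_sup_right ?_
    rw [LinearMap.mem_ker]
    exact Subsingleton.elim _ _

/-- **The lift node needs the degrees `2p ≤ d` only: `CMFibreAlgebraicLift` ⟺ "(L)_t(p) at every CM point of every compact abelian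
pencil for `2p ≤ d`".** [cite: Andre1996Motifs, §5.1 and Remarque 2 (p. 33)] [cite: VoisinHodgeI2002, §6.2.3 Thm. 6.25] -/
theorem cmFibreAlgebraicLift_iff_le_half :
    CMFibreAlgebraicLift ↔ ∀ ⦃d : ℕ⦄ ⦃𝒳 S : SchemeOver ℂ⦄ (f : 𝒳 ⟶ S), IsCompactAbelianPencil f d →
      ∀ (p : ℕ), 2 * p ≤ d → ∀ t ∈ cmLocus f d,
        (algebraicClasses (fiberOver f t) p).comap (complexBetti.map (fiberι f t) (2 * p)).hom ≤
          algebraicClasses 𝒳 p ⊔ LinearMap.ker (complexBetti.map (fiberι f t) (2 * p)).hom := by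
  rw [cmFibreAlgebraicLift_iff_comap_le_sup]
  exact ⟨fun h d 𝒳 S f hf p _ t ht ↦ h f hf p t ht,
    fun h d 𝒳 S f hf p t ht ↦ (forall_comap_le_sup_iff_le_half hf t).2 (fun p' hp' ↦ h f hf p' hp' t ht) p⟩

end Summit.HodgeConjecture.HodgeConjecture.Ring2.AbelianAll

end
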